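import Summits.ResolutionOfSingularities.ResolutionOfSingularities.Theorems.WeightedInvariantIota3SigmaFlagSpecialise
import HarnessLib

/-!
# Flags of `S(X)` specialise over LARGE FINITE residue fields — degree bound on the cotangent minor ((o39) sequel, (D-c) input)

Route `ResolutionOfSingularities/WeightedInvariant`, crux `Theses.WeightedInvariant.HypersurfaceCentreConstruction`
(stmt-ResolutionOfSingularities-19897), P3 rung, clause (c10σ); res-L1-w43-plan-1 RULING gen 11 #5 (2) Q2 (res-type-057).
Sequel of `WeightedInvariantIota3SigmaFlagSpecialise` (p542470): the cotangent minor `Δ = θG₁·ψG₂ − θG₂·ψG₁ ∈ κ[X]` has degree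
`≤ deg G₁ + deg G₂` (`natDegree_minor_le`), so a two-flag `(G₁/1, G₂/1)` of `S(X)` with polynomial members specialises to a two-flag
`(G₁(a), G₂(a))` of `S` with `ā ∉ B` as soon as the residue field has MORE THAN `deg G₁ + deg G₂ + |B|` elements
(`isTwoFlag_specialises_of_card`) — finite residue fields included.  This is the quantitative input of the finite-residue-field
route (D-c) (pass to a finite separable residue extension of large degree; design note `plan/tools/res-type-057/SIGMA-DESCENT-SX.md`).

Def-free helper (`--supports stmt-ResolutionOfSingularities-19897`); OURS bookkeeping; no claim about resolution in positive characteristic.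
AI-written; weaker than expert review.  [OURS · L1 W4.3 · (o39) sequel]  [cite: Matsumura1987, §8]
-/

noncomputable section

set_option linter.dupNamespace false -- mandated namespace of this single-conjunct summit

open IsLocalRing Polynomial Literature.AlgebraicGeometry.Resolution
open Summit.ResolutionOfSingularities.ResolutionOfSingularities.Theorems

namespace Summit.ResolutionOfSingularities.ResolutionOfSingularities.Cruxes.HypersurfaceCentreConstruction.LocalEngine

namespace Iota3

section Card

variable {S : Type} [CommRing S] [IsLocalRing S]

/-- The transform `θG` has degree at most `deg G`. [folklore] -/
theorem natDegree_cotangentFunctional_transform_le {θ : S → ResidueField S}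
    (hmul : ∀ s x : S, x ∈ maximalIdeal S → θ (s * x) = residue S s * θ x)
    {G : S[X]} {P : (ResidueField S)[X]} (hP : ∀ n, P.coeff n = θ (G.coeff n)) :
    P.natDegree ≤ G.natDegree := by
  refine (Polynomial.natDegree_le_iff_coeff_eq_zero).mpr fun i hi => ?_
  rw [hP, Polynomial.coeff_eq_zero_of_natDegree_lt (by exact_mod_cast hi), cotangentFunctional_zero hmul]

/-- **The cotangent minor has degree at most `deg G₁ + deg G₂`** — the quantitative input of the finite-residue-field route
((D-c): pass to a residue extension with more than `deg G₁ + deg G₂ + |B|` elements). [folklore] -/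
theorem natDegree_minor_le {θ ψ : S → ResidueField S}
    (hθmul : ∀ s x : S, x ∈ maximalIdeal S → θ (s * x) = residue S s * θ x)
    (hψmul : ∀ s x : S, x ∈ maximalIdeal S → ψ (s * x) = residue S s * ψ x)
    {G₁ G₂ : S[X]} {A₁ A₂ B₁ B₂ : (ResidueField S)[X]}
    (hA₁ : ∀ n, A₁.coeff n = θ (G₁.coeff n)) (hA₂ : ∀ n, A₂.coeff n = θ (G₂.coeff n))
    (hB₁ : ∀ n, B₁.coeff n = ψ (G₁.coeff n)) (hB₂ : ∀ n, B₂.coeff n = ψ (G₂.coeff n)) :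
    (A₁ * B₂ - A₂ * B₁).natDegree ≤ G₁.natDegree + G₂.natDegree := by
  have h₁ := natDegree_cotangentFunctional_transform_le hθmul hA₁
  have h₂ := natDegree_cotangentFunctional_transform_le hθmul hA₂
  have h₃ := natDegree_cotangentFunctional_transform_le hψmul hB₁
  have h₄ := natDegree_cotangentFunctional_transform_le hψmul hB₂
  refine (Polynomial.natDegree_sub_le _ _).trans (max_le ?_ ?_)
  · exact Polynomial.natDegree_mul_le.trans (by omega)
  · exact Polynomial.natDegree_mul_le.trans (by omega)

/-- **FLAGS OF `S(X)` WITH POLYNOMIAL MEMBERS SPECIALISE as soon as the residue field has MORE THAN `deg G₁ + deg G₂ + |B|`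
elements** (finite residue fields included): the bad residues are `B` and the at most `deg G₁ + deg G₂` roots of the cotangent
minor. [folklore] -/
theorem isTwoFlag_specialises_of_card [Finite (ResidueField S)] (G₁ G₂ : S[X])
    (h : IsTwoFlag (algebraMap S[X] (Localization.AtPrime ((maximalIdeal S).map (C : S →+* S[X]))) G₁)
      (algebraMap S[X] (Localization.AtPrime ((maximalIdeal S).map (C : S →+* S[X]))) G₂))
    (B : Finset (ResidueField S)) (hcard : G₁.natDegree + G₂.natDegree + B.card < Nat.card (ResidueField S)) :
    ∃ a : S, residue S a ∉ B ∧ IsTwoFlag (Polynomial.aeval a G₁) (Polynomial.aeval a G₂) := by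
  classical
  haveI := Fintype.ofFinite (ResidueField S)
  obtain ⟨hG₁, hG₂, hstar⟩ := isTwoFlag_genericFibre_polynomial h
  obtain ⟨θ, ψ, hθadd, hθmul, hθsq, hψadd, hψmul, hψsq, A₁, A₂, B₁, B₂, hA₁, hA₂, hB₁, hB₂, hΔ⟩ :=
    exists_minor_ne_zero hG₁ hG₂ hstar
  have hdeg := natDegree_minor_le hθmul hψmul hA₁ hA₂ hB₁ hB₂
  have hT : (B ∪ (A₁ * B₂ - A₂ * B₁).roots.toFinset).card < Fintype.card (ResidueField S) := by
    rw [← Nat.card_eq_fintype_card]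
    refine lt_of_le_of_lt ((Finset.card_union_le _ _).trans ?_) hcard
    have := (Multiset.toFinset_card_le (A₁ * B₂ - A₂ * B₁).roots).trans (Polynomial.card_roots' _)
    omega
  have hT' : (B ∪ (A₁ * B₂ - A₂ * B₁).roots.toFinset).card < (Finset.univ : Finset (ResidueField S)).card := by
    rwa [Finset.card_univ]
  obtain ⟨r, -, hr⟩ := Finset.exists_mem_notMem_of_card_lt_card hT'
  obtain ⟨a, rfl⟩ := IsLocalRing.residue_surjective r
  rw [Finset.mem_union, not_or, Multiset.mem_toFinset, Polynomial.mem_roots hΔ] at hr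
  refine ⟨a, hr.1, isTwoFlag_aeval_of_minor_ne_zero hθadd hθmul hθsq hψadd hψmul hψsq hG₁ hG₂ hA₁ hA₂ hB₁ hB₂ ?_⟩
  intro h0
  apply hr.2
  rw [Polynomial.IsRoot.def, Polynomial.eval_sub, Polynomial.eval_mul, Polynomial.eval_mul]
  exact h0

end Card

end Iota3

end Summit.ResolutionOfSingularities.ResolutionOfSingularities.Cruxes.HypersurfaceCentreConstruction.LocalEngine
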